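import Summits.BirchSwinnertonDyer.BirchSwinnertonDyer.Theorems.PrintCFramBottomClassIndexLawFiveLeHerbrandSelmerToHom
import HarnessLib

/-!
# Crux `PrintCFram.BottomClassIndexLawFiveLe` (stmt-BirchSwinnertonDyer-20372), line `eisenstein-resource-bdp-line` (v10):
# Stub H, typing item T2′ ON THE CLASS — both bottom-layer residual Selmer groups of a stable line `Φ ≤ W_{K''}[p]`
# reduced to their Hom-side (the input of T4), with T2, continuity and non-triviality discharged

Cell `bsd-print-cfram`, width seat `bsd-line-cfram-p1-w4` (generation g5), `--supports stmt-BirchSwinnertonDyer-20372` (helper);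
companion of `…HerbrandSelmerToHom.lean` (the generic socket `datumStrictSelmer_bdpData_eq_bot_of_forall_hom_of_top`).
THEOREMS ONLY; no definition, no named fact, no `sorry`. BSD is not proved by any of this; no summit statement is proved
by this seat; no stub is closed.

WHAT. Stub H (`stub_bottomResidualSelmer_trivial_of_bernoulliPair`) concludes, for `W/ℚ` CM, `p ≥ 5` CM-ramified, a
Heegner field `K''`, `κ`, `𝔭 ∋ p` and every `Γ_{K''}`-stable line `Φ ≤ W_{K''}[p]` of order `p`, that
`datumStrictSelmer (κ.layerSubgroup 0) Φ.Sub p (bdpData Φ.Sub p 𝔭) S = ⊥` and the same for `Φ.Quot`. Here, with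
EXACTLY those quantifiers (any quadratic `K`, any set `S₀` of finite places):
* `exists_smul_ne_sub_of_cmRamified` — some `σ ∈ Γ_K` moves a vector of `Φ` AND of `W_K[p]/Φ` (the central homothety
  `d ≢ 1 (mod p)` of `BorelHomothety.exists_central_homothety_of_cmRamified`, as in T2's
  `HerbrandLineRestriction.subgroupResKer_ker_eq_bot_of_cmRamified`);
* **`bottomResidualSelmer_sub_eq_bot_of_forall_hom`**, **`bottomResidualSelmer_quot_eq_bot_of_forall_hom`** — each of
  Stub H's two conclusions follows from ONE Hom-vanishing statement over `Γ_K`: «every continuous `f : Γ_K → Φ`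
  (resp. `→ W_K[p]/Φ`) additive and `Γ_K`-equivariant on `N = ker(Γ_K → Aut Φ)` (resp. `Aut(W_K[p]/Φ)`), killing
  `N ∩ σ⁻¹ I_v σ` for `v ∉ S₀`, `v ∤ p` and `N ∩ σ⁻¹ D_𝔭 σ`, vanishes on `N`» — M1 §2's
  `Hom_cont(Γ_L, 𝔽_p(θ))^{[θ]}` with the local conditions, `L = K(θ)`, `θ` the character of the line (T1:
  `θ_Φ θ_{W[p]/Φ} = χ̄_p`, `θ_{W[p]/Φ} = ±θ_Φ`, LEAD g8 `HerbrandLineCharacters`); its vanishing is M1 §§3–6 =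
  T4 (class field theory over `L`) + T5 (F1–F4);
* `bottomResidualSelmer_eq_bot_and_eq_bot_of_forall_hom` — both conjuncts at once, in Stub H's shape.

References: Greenberg, LNM 1716 (1999) §3 (PDF p. 86); Greenberg–Vatsal 2000 §2 pp. 16–17; Kriz–Li 2019 p. 3
(«relative `p`-class numbers of abelian extensions»); the herbrand line card and M1 memo (crux workfiles).
-/

noncomputable section

-- summit-side namespace `Summit.BirchSwinnertonDyer.BirchSwinnertonDyer.…` (single-conjunct summit, D-0017 layout)
set_option linter.dupNamespace false
set_option autoImplicit false

open scoped Classical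
open NumberField WeierstrassCurve IsDedekindDomain Field
open Literature.NumberTheory.EllipticCurves
open Literature.NumberTheory.EllipticCurves.GreenbergSelmer
open Literature.NumberTheory.EllipticCurves.GreenbergVatsal2000
open Literature.NumberTheory.GaloisRepresentations
open Summit.BirchSwinnertonDyer.Rank1Residual
open Summit.BirchSwinnertonDyer.Rank1Residual.X11b

namespace Summit.BirchSwinnertonDyer.BirchSwinnertonDyer.Theorems.PrintCFram.HerbrandSelmerToHom

/-! ## §4 The socket in CHARACTER currency: homomorphisms `Γ_K → ℤ/p`, `N = ker θ` -/

section Character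

variable {K : Type} [Field K] [NumberField K] {p : ℕ} [hp : Fact p.Prime]
variable (H : Subgroup (absoluteGaloisGroup K)) [H.Normal]
variable {M : Type} [AddCommGroup M] [DistribMulAction (absoluteGaloisGroup K) M] [TopologicalSpace M]
  [DiscreteTopology M]

/-- **THE SOCKET IN CHARACTER CURRENCY** (the form class field theory over `L = K̄^{ker θ}` speaks). Let `M` be a
discrete `Γ_K`-module of prime order `p` with continuous orbit maps and non-trivial action, and `θ : Γ_K →* (ℤ/p)ˣ`
its character (`g • m = θ(g) • m`, `ker θ` = kernel of the action — T2's `exists_character_of_card_prime`). For `H`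
containing every element (`Γ_K` itself, `κ.layerSubgroup 0`): **`datumStrictSelmer H M p (bdpData M p 𝔭) S₀ = ⊥`** as
soon as every continuous `f : Γ_K → ℤ/p` which on `N = ker θ` is additive and satisfies **`f(g n g⁻¹) = θ(g) f(n)`**,
kills `N ∩ σ⁻¹ I_v σ` (`v ∉ S₀`, `v ∤ p`, all `σ`) and `N ∩ σ⁻¹ D_𝔭 σ` (all `σ`), vanishes on `N` — i.e.
«`Hom_cont(Γ_L, 𝔽_p(θ))^{[θ]}` unramified outside `S₀` away from `p`, split above `𝔭`, free above the other primes
over `p`, is `0`», M1 §2. (Transport along an additive isomorphism `M ≃+ ℤ/p`; both are cyclic of order `p`.)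
[cite: GreenbergLNM1716, §3 (PDF p. 86)] [cite: SerreGaloisCohomology1997, I.§2.6 (b)] [cite: GreenbergVatsal2000, §2 pp. 16–17] -/
theorem datumStrictSelmer_bdpData_eq_bot_of_forall_hom_character (hH : ∀ g : absoluteGaloisGroup K, g ∈ H)
    (hcard : Nat.card M = p) (hcont : ∀ m : M, Continuous fun g : absoluteGaloisGroup K ↦ g • m)
    (hnt : ∃ (σ : absoluteGaloisGroup K) (a : M), σ • a ≠ a)
    (θ : absoluteGaloisGroup K →* (ZMod p)ˣ)
    (hθ : ∀ (g : absoluteGaloisGroup K) (m : M), g • m = (((θ g : ZMod p).val : ℕ) : ℤ) • m)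
    (hker : ∀ g : absoluteGaloisGroup K, θ g = 1 ↔ ∀ m : M, g • m = m)
    (𝔭 : HeightOneSpectrum (𝓞 K)) (h𝔭 : ((p : ℕ) : 𝓞 K) ∈ 𝔭.asIdeal) (S₀ : Set (HeightOneSpectrum (𝓞 K)))
    (hhom : ∀ f : absoluteGaloisGroup K → ZMod p, Continuous f →
      (∀ a b : absoluteGaloisGroup K, θ a = 1 → θ b = 1 → f (a * b) = f a + f b) →
      (∀ g n : absoluteGaloisGroup K, θ n = 1 → f (g * n * g⁻¹) = (θ g : ZMod p) * f n) →
      (∀ v : HeightOneSpectrum (𝓞 K), v ∉ S₀ → ((p : ℕ) : 𝓞 K) ∉ v.asIdeal →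
        ∀ σ n : absoluteGaloisGroup K, θ n = 1 → σ * n * σ⁻¹ ∈ inertia v → f n = 0) →
      (∀ σ n : absoluteGaloisGroup K, θ n = 1 → σ * n * σ⁻¹ ∈ decomp 𝔭 → f n = 0) →
      ∀ n : absoluteGaloisGroup K, θ n = 1 → f n = 0) :
    datumStrictSelmer H M p (AcSelmer.bdpData M p 𝔭) S₀ = ⊥ := by
  haveI : IsAddCyclic M := isAddCyclic_of_prime_card hcard
  let e : M ≃+ ZMod p := addEquivOfAddCyclicCardEq (by rw [hcard, Nat.card_zmod])
  refine datumStrictSelmer_bdpData_eq_bot_of_forall_hom_of_top H hH hcard hcont hnt 𝔭 h𝔭 S₀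
    fun F hF hadd hconj hU hS n hn ↦ ?_
  -- the transported map `f = e ∘ F : Γ_K → ℤ/p`
  have heq : ∀ (g n : absoluteGaloisGroup K), θ n = 1 → e (F (g * n * g⁻¹)) = (θ g : ZMod p) * e (F n) := by
    intro g n hn1
    rw [hconj g n ((hker n).1 hn1), hθ g, map_zsmul, zsmul_eq_mul, Int.cast_natCast, ZMod.natCast_zmod_val]
  have key := hhom (fun g ↦ e (F g)) (continuous_of_discreteTopology.comp hF)
    (fun a b ha hb ↦ by rw [hadd a b ((hker a).1 ha) ((hker b).1 hb), map_add])
    heq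
    (fun v hv hpv σ m hm hmI ↦ by rw [hU v hv hpv σ m ((hker m).1 hm) hmI, map_zero])
    (fun σ m hm hmD ↦ by rw [hS σ m ((hker m).1 hm) hmD, map_zero])
    n ((hker n).2 hn)
  exact e.map_eq_zero_iff.1 key

end Character

/-! ## §5 On the class, with Stub H's quantifiers -/

section Class

variable {p : ℕ} [hp : Fact p.Prime]

/-- **Non-triviality on `Φ` for free.** For `W/ℚ` with CM, `p ≥ 5` CM-ramified, ANY quadratic `K` and ANY stable
`Φ ≤ W_K[p]` of order `p`, some `σ ∈ Γ_K` moves some vector of `Φ`: `ρ̄(Γ_K)` contains a central homothety `d` with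
`d ≢ 1 (mod p)` (`BorelHomothety.exists_central_homothety_of_cmRamified`, level `1`). (As in T2's
`subgroupResKer_ker_eq_bot_of_cmRamified`.) [cite: GrigorovJorzaPatrikisSteinTarnita2009, Prop. 5.4 (mechanism)] -/
theorem exists_smul_ne_sub_of_cmRamified (W : WeierstrassCurve ℚ) [W.IsElliptic] (hCM : W.HasCM)
    (hram : Rank1Residual.CMRamified W p) (h5 : 5 ≤ p) (K : Type) [Field K] [NumberField K]
    (hK2 : Module.finrank ℚ K = 2)
    (Φ : X2.ResidualDevissageModules.StableSubgroup (absoluteGaloisGroup K) ((W.baseChange K).geomTorsion (p : ℤ)))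
    (hcard : Nat.card Φ.Sub = p) :
    (∃ (σ : absoluteGaloisGroup K) (x : Φ.Sub), σ • x ≠ x) ∧
      ∃ (σ : absoluteGaloisGroup K) (y : Φ.Quot), σ • y ≠ y := by
  haveI hE : (W.baseChange K).IsElliptic := by unfold WeierstrassCurve.baseChange; infer_instance
  obtain ⟨g₀, d, hcop, hg₀⟩ :=
    BorelHomothety.exists_central_homothety_of_cmRamified W p K hCM h5 hram hK2 (M := 1) le_rfl
  have hg : ∀ P : (W.baseChange K).geomTorsion (p : ℤ), g₀ • P = d • P := by
    intro P
    have hmem : (P : (W.baseChange K).geomPoints) ∈ (W.baseChange K).geomTorsion ((p ^ 1 : ℕ) : ℤ) := by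
      rw [pow_one]; exact P.2
    have h := congrArg Subtype.val (hg₀ ⟨P, hmem⟩)
    exact Subtype.ext h
  have hpd : ¬ (p : ℤ) ∣ d - 1 := by
    intro h
    have hu : IsUnit (((p ^ 1 : ℕ) : ℤ)) := by
      have hc : IsCoprime (((p ^ 1 : ℕ) : ℤ)) (((p ^ 1 : ℕ) : ℤ)) :=
        hcop.of_isCoprime_of_dvd_left (by rw [pow_one]; exact h)
      exact isCoprime_self.mp hc
    rw [pow_one, Int.isUnit_iff_natAbs_eq, Int.natAbs_natCast] at hu
    exact hp.out.one_lt.ne' hu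
  have hcardQ : Nat.card Φ.Quot = p := HerbrandLineRestriction.natCard_quot_eq_of_card_sub (W.baseChange K) Φ hcard
  constructor
  · haveI : Finite Φ.Sub := Nat.finite_of_card_ne_zero (by rw [hcard]; exact hp.out.ne_zero)
    haveI : Nontrivial Φ.Sub := Finite.one_lt_card_iff_nontrivial.mp (by rw [hcard]; exact hp.out.one_lt)
    obtain ⟨x, hx⟩ := exists_ne (0 : Φ.Sub)
    refine ⟨g₀, x, fun h ↦ hpd (HerbrandLineRestriction.prime_dvd_of_zsmul_eq_zero hcard hx (n := d - 1) ?_)⟩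
    have hdx : g₀ • x = d • x := Φ.incl_injective (by rw [Φ.incl_smul, map_zsmul, hg])
    rw [sub_smul, one_smul, ← hdx, h, sub_self]
  · haveI : Finite Φ.Quot := Nat.finite_of_card_ne_zero (by rw [hcardQ]; exact hp.out.ne_zero)
    haveI : Nontrivial Φ.Quot := Finite.one_lt_card_iff_nontrivial.mp (by rw [hcardQ]; exact hp.out.one_lt)
    obtain ⟨y, hy⟩ := exists_ne (0 : Φ.Quot)
    refine ⟨g₀, y, fun h ↦ hpd (HerbrandLineRestriction.prime_dvd_of_zsmul_eq_zero hcardQ hy (n := d - 1) ?_)⟩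
    obtain ⟨m, rfl⟩ := Φ.proj_surjective y
    have hdy : g₀ • Φ.proj m = d • Φ.proj m := by rw [Φ.smul_proj, hg, map_zsmul]
    rw [sub_smul, one_smul, ← hdy, h, sub_self]

/-- **Stub H, the `Φ`-conjunct, REDUCED TO ITS HOM-SIDE** (T2 injectivity, continuity and non-triviality discharged).
For `W/ℚ` with CM, `p ≥ 5` CM-ramified, a quadratic field `K`, any `ℤ_p`-extension `κ` (only `κ.layerSubgroup 0 = Γ_K`
enters), any `𝔭 ∋ p`, any set `S₀` of finite places and ANY `Γ_K`-stable line `Φ ≤ W_K[p]` of order `p`: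
`R_𝔭^{S₀}(K, Φ) := datumStrictSelmer (κ.layerSubgroup 0) Φ.Sub p (bdpData Φ.Sub p 𝔭) S₀ = ⊥` as soon as every
continuous `f : Γ_K → Φ` which is additive and `Γ_K`-equivariant on `N = ker(Γ_K → Aut Φ)` and kills
`N ∩ σ⁻¹ I_v σ` (`v ∉ S₀`, `v ∤ p`) and `N ∩ σ⁻¹ D_𝔭 σ` vanishes on `N`. With T1 (`θ = ψ̄|` or `ψ̄⁻¹ω̄|`, LEAD g7/g8)
the hypothesis is «`Hom_cont(Γ_{K(θ)}, 𝔽_p(θ))^{[θ]}` unramified outside `S₀ ∪ {w ∣ p}`-above-`𝔭̄`, split above `𝔭`,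
is `0`» — M1 §§3–6 (T4 + T5). [cite: GreenbergLNM1716, §3 (PDF p. 86)] [cite: KrizLi2019, p. 3 («relative p-class numbers»)]
[cite: GreenbergVatsal2000, §2 pp. 16–17] -/
theorem bottomResidualSelmer_sub_eq_bot_of_forall_hom (W : WeierstrassCurve ℚ) [W.IsElliptic] (hCM : W.HasCM)
    (hram : Rank1Residual.CMRamified W p) (h5 : 5 ≤ p) (K : Type) [Field K] [NumberField K]
    (hK2 : Module.finrank ℚ K = 2) (κ : ZpExtension K p) (𝔭 : HeightOneSpectrum (𝓞 K))
    (h𝔭 : ((p : ℕ) : 𝓞 K) ∈ 𝔭.asIdeal) (S₀ : Set (HeightOneSpectrum (𝓞 K)))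
    (Φ : X2.ResidualDevissageModules.StableSubgroup (absoluteGaloisGroup K) ((W.baseChange K).geomTorsion (p : ℤ)))
    (hcard : Nat.card Φ.Sub = p)
    (hhom : ∀ f : absoluteGaloisGroup K → Φ.Sub, Continuous f →
      (∀ a b : absoluteGaloisGroup K, (∀ m : Φ.Sub, a • m = m) → (∀ m : Φ.Sub, b • m = m) →
        f (a * b) = f a + f b) →
      (∀ g n : absoluteGaloisGroup K, (∀ m : Φ.Sub, n • m = m) → f (g * n * g⁻¹) = g • f n) →
      (∀ v : HeightOneSpectrum (𝓞 K), v ∉ S₀ → ((p : ℕ) : 𝓞 K) ∉ v.asIdeal →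
        ∀ σ n : absoluteGaloisGroup K, (∀ m : Φ.Sub, n • m = m) → σ * n * σ⁻¹ ∈ inertia v → f n = 0) →
      (∀ σ n : absoluteGaloisGroup K, (∀ m : Φ.Sub, n • m = m) → σ * n * σ⁻¹ ∈ decomp 𝔭 → f n = 0) →
      ∀ n : absoluteGaloisGroup K, (∀ m : Φ.Sub, n • m = m) → f n = 0) :
    datumStrictSelmer (κ.layerSubgroup 0) Φ.Sub p (AcSelmer.bdpData Φ.Sub p 𝔭) S₀ = ⊥ := by
  haveI hE : (W.baseChange K).IsElliptic := by unfold WeierstrassCurve.baseChange; infer_instance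
  exact datumStrictSelmer_bdpData_eq_bot_of_forall_hom_of_top (κ.layerSubgroup 0)
    (fun g ↦ by rw [ZpExtension.layerSubgroup_zero]; exact Subgroup.mem_top g) hcard
    (Φ.continuous_smul_sub (HerbrandLineRestriction.continuous_smul_geomTorsion (W.baseChange K) (p : ℤ)))
    (exists_smul_ne_sub_of_cmRamified W hCM hram h5 K hK2 Φ hcard).1 𝔭 h𝔭 S₀ hhom

/-- **Stub H, the `W[p]/Φ`-conjunct, REDUCED TO ITS HOM-SIDE**: the same for the quotient line `Φ.Quot` (order `p`,
`HerbrandLineRestriction.natCard_quot_eq_of_card_sub`; its character is `θ' = θ⁻¹ω̄|`, LEAD g8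
`HerbrandLineCharacters`). [cite: GreenbergLNM1716, §3 (PDF p. 86)] [cite: GreenbergVatsal2000, §2 pp. 16–17] -/
theorem bottomResidualSelmer_quot_eq_bot_of_forall_hom (W : WeierstrassCurve ℚ) [W.IsElliptic] (hCM : W.HasCM)
    (hram : Rank1Residual.CMRamified W p) (h5 : 5 ≤ p) (K : Type) [Field K] [NumberField K]
    (hK2 : Module.finrank ℚ K = 2) (κ : ZpExtension K p) (𝔭 : HeightOneSpectrum (𝓞 K))
    (h𝔭 : ((p : ℕ) : 𝓞 K) ∈ 𝔭.asIdeal) (S₀ : Set (HeightOneSpectrum (𝓞 K)))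
    (Φ : X2.ResidualDevissageModules.StableSubgroup (absoluteGaloisGroup K) ((W.baseChange K).geomTorsion (p : ℤ)))
    (hcard : Nat.card Φ.Sub = p)
    (hhom : ∀ f : absoluteGaloisGroup K → Φ.Quot, Continuous f →
      (∀ a b : absoluteGaloisGroup K, (∀ m : Φ.Quot, a • m = m) → (∀ m : Φ.Quot, b • m = m) →
        f (a * b) = f a + f b) →
      (∀ g n : absoluteGaloisGroup K, (∀ m : Φ.Quot, n • m = m) → f (g * n * g⁻¹) = g • f n) →
      (∀ v : HeightOneSpectrum (𝓞 K), v ∉ S₀ → ((p : ℕ) : 𝓞 K) ∉ v.asIdeal →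
        ∀ σ n : absoluteGaloisGroup K, (∀ m : Φ.Quot, n • m = m) → σ * n * σ⁻¹ ∈ inertia v → f n = 0) →
      (∀ σ n : absoluteGaloisGroup K, (∀ m : Φ.Quot, n • m = m) → σ * n * σ⁻¹ ∈ decomp 𝔭 → f n = 0) →
      ∀ n : absoluteGaloisGroup K, (∀ m : Φ.Quot, n • m = m) → f n = 0) :
    datumStrictSelmer (κ.layerSubgroup 0) Φ.Quot p (AcSelmer.bdpData Φ.Quot p 𝔭) S₀ = ⊥ := by
  haveI hE : (W.baseChange K).IsElliptic := by unfold WeierstrassCurve.baseChange; infer_instance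
  exact datumStrictSelmer_bdpData_eq_bot_of_forall_hom_of_top (κ.layerSubgroup 0)
    (fun g ↦ by rw [ZpExtension.layerSubgroup_zero]; exact Subgroup.mem_top g)
    (HerbrandLineRestriction.natCard_quot_eq_of_card_sub (W.baseChange K) Φ hcard)
    (Φ.continuous_smul_quot (HerbrandLineRestriction.continuous_smul_geomTorsion (W.baseChange K) (p : ℤ)))
    (exists_smul_ne_sub_of_cmRamified W hCM hram h5 K hK2 Φ hcard).2 𝔭 h𝔭 S₀ hhom

/-- **Stub H's two conclusions at once, reduced to their Hom-sides** (same quantifiers; the bad set `S₀` arbitrary,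
Stub H's is `{v : W_K bad at v, v ∤ p}`). [cite: GreenbergLNM1716, §3 (PDF p. 86)] [cite: GreenbergVatsal2000, §2 pp. 16–17] -/
theorem bottomResidualSelmer_eq_bot_and_eq_bot_of_forall_hom (W : WeierstrassCurve ℚ) [W.IsElliptic]
    (hCM : W.HasCM) (hram : Rank1Residual.CMRamified W p) (h5 : 5 ≤ p) (K : Type) [Field K] [NumberField K]
    (hK2 : Module.finrank ℚ K = 2) (κ : ZpExtension K p) (𝔭 : HeightOneSpectrum (𝓞 K))
    (h𝔭 : ((p : ℕ) : 𝓞 K) ∈ 𝔭.asIdeal) (S₀ : Set (HeightOneSpectrum (𝓞 K)))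
    (Φ : X2.ResidualDevissageModules.StableSubgroup (absoluteGaloisGroup K) ((W.baseChange K).geomTorsion (p : ℤ)))
    (hcard : Nat.card Φ.Sub = p)
    (hhomS : ∀ f : absoluteGaloisGroup K → Φ.Sub, Continuous f →
      (∀ a b : absoluteGaloisGroup K, (∀ m : Φ.Sub, a • m = m) → (∀ m : Φ.Sub, b • m = m) →
        f (a * b) = f a + f b) →
      (∀ g n : absoluteGaloisGroup K, (∀ m : Φ.Sub, n • m = m) → f (g * n * g⁻¹) = g • f n) →
      (∀ v : HeightOneSpectrum (𝓞 K), v ∉ S₀ → ((p : ℕ) : 𝓞 K) ∉ v.asIdeal →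
        ∀ σ n : absoluteGaloisGroup K, (∀ m : Φ.Sub, n • m = m) → σ * n * σ⁻¹ ∈ inertia v → f n = 0) →
      (∀ σ n : absoluteGaloisGroup K, (∀ m : Φ.Sub, n • m = m) → σ * n * σ⁻¹ ∈ decomp 𝔭 → f n = 0) →
      ∀ n : absoluteGaloisGroup K, (∀ m : Φ.Sub, n • m = m) → f n = 0)
    (hhomQ : ∀ f : absoluteGaloisGroup K → Φ.Quot, Continuous f →
      (∀ a b : absoluteGaloisGroup K, (∀ m : Φ.Quot, a • m = m) → (∀ m : Φ.Quot, b • m = m) →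
        f (a * b) = f a + f b) →
      (∀ g n : absoluteGaloisGroup K, (∀ m : Φ.Quot, n • m = m) → f (g * n * g⁻¹) = g • f n) →
      (∀ v : HeightOneSpectrum (𝓞 K), v ∉ S₀ → ((p : ℕ) : 𝓞 K) ∉ v.asIdeal →
        ∀ σ n : absoluteGaloisGroup K, (∀ m : Φ.Quot, n • m = m) → σ * n * σ⁻¹ ∈ inertia v → f n = 0) →
      (∀ σ n : absoluteGaloisGroup K, (∀ m : Φ.Quot, n • m = m) → σ * n * σ⁻¹ ∈ decomp 𝔭 → f n = 0) →
      ∀ n : absoluteGaloisGroup K, (∀ m : Φ.Quot, n • m = m) → f n = 0) :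
    datumStrictSelmer (κ.layerSubgroup 0) Φ.Sub p (AcSelmer.bdpData Φ.Sub p 𝔭) S₀ = ⊥ ∧
      datumStrictSelmer (κ.layerSubgroup 0) Φ.Quot p (AcSelmer.bdpData Φ.Quot p 𝔭) S₀ = ⊥ :=
  ⟨bottomResidualSelmer_sub_eq_bot_of_forall_hom W hCM hram h5 K hK2 κ 𝔭 h𝔭 S₀ Φ hcard hhomS,
    bottomResidualSelmer_quot_eq_bot_of_forall_hom W hCM hram h5 K hK2 κ 𝔭 h𝔭 S₀ Φ hcard hhomQ⟩

/-- **Stub H's `Φ`-conjunct in CHARACTER currency, on the class.** With the character `θ_Φ : Γ_K →* (ℤ/p)ˣ` of the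
line (T2 `exists_character_of_card_prime`; T1: `θ_Φ = ψ̄|` or `ψ̄⁻¹ω̄|` on the Kriz–Li locus): `R_𝔭^{S₀}(K, Φ) = ⊥` as
soon as every continuous `f : Γ_K → ℤ/p`, additive on `ker θ_Φ` with `f(g n g⁻¹) = θ_Φ(g) f(n)`, killing
`ker θ_Φ ∩ σ⁻¹ I_v σ` (`v ∉ S₀`, `v ∤ p`) and `ker θ_Φ ∩ σ⁻¹ D_𝔭 σ`, vanishes on `ker θ_Φ`.
[cite: GreenbergLNM1716, §3 (PDF p. 86)] [cite: KrizLi2019, p. 3 («relative p-class numbers»)] -/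
theorem bottomResidualSelmer_sub_eq_bot_of_forall_hom_character (W : WeierstrassCurve ℚ) [W.IsElliptic]
    (hCM : W.HasCM) (hram : Rank1Residual.CMRamified W p) (h5 : 5 ≤ p) (K : Type) [Field K] [NumberField K]
    (hK2 : Module.finrank ℚ K = 2) (κ : ZpExtension K p) (𝔭 : HeightOneSpectrum (𝓞 K))
    (h𝔭 : ((p : ℕ) : 𝓞 K) ∈ 𝔭.asIdeal) (S₀ : Set (HeightOneSpectrum (𝓞 K)))
    (Φ : X2.ResidualDevissageModules.StableSubgroup (absoluteGaloisGroup K) ((W.baseChange K).geomTorsion (p : ℤ)))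
    (hcard : Nat.card Φ.Sub = p) (θ : absoluteGaloisGroup K →* (ZMod p)ˣ)
    (hθ : ∀ (g : absoluteGaloisGroup K) (x : Φ.Sub), g • x = (((θ g : ZMod p).val : ℕ) : ℤ) • x)
    (hker : ∀ g : absoluteGaloisGroup K, θ g = 1 ↔ ∀ x : Φ.Sub, g • x = x)
    (hhom : ∀ f : absoluteGaloisGroup K → ZMod p, Continuous f →
      (∀ a b : absoluteGaloisGroup K, θ a = 1 → θ b = 1 → f (a * b) = f a + f b) →
      (∀ g n : absoluteGaloisGroup K, θ n = 1 → f (g * n * g⁻¹) = (θ g : ZMod p) * f n) →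
      (∀ v : HeightOneSpectrum (𝓞 K), v ∉ S₀ → ((p : ℕ) : 𝓞 K) ∉ v.asIdeal →
        ∀ σ n : absoluteGaloisGroup K, θ n = 1 → σ * n * σ⁻¹ ∈ inertia v → f n = 0) →
      (∀ σ n : absoluteGaloisGroup K, θ n = 1 → σ * n * σ⁻¹ ∈ decomp 𝔭 → f n = 0) →
      ∀ n : absoluteGaloisGroup K, θ n = 1 → f n = 0) :
    datumStrictSelmer (κ.layerSubgroup 0) Φ.Sub p (AcSelmer.bdpData Φ.Sub p 𝔭) S₀ = ⊥ := by
  haveI hE : (W.baseChange K).IsElliptic := by unfold WeierstrassCurve.baseChange; infer_instance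
  exact datumStrictSelmer_bdpData_eq_bot_of_forall_hom_character (κ.layerSubgroup 0)
    (fun g ↦ by rw [ZpExtension.layerSubgroup_zero]; exact Subgroup.mem_top g) hcard
    (Φ.continuous_smul_sub (HerbrandLineRestriction.continuous_smul_geomTorsion (W.baseChange K) (p : ℤ)))
    (exists_smul_ne_sub_of_cmRamified W hCM hram h5 K hK2 Φ hcard).1 θ hθ hker 𝔭 h𝔭 S₀ hhom

/-- **Stub H's `W[p]/Φ`-conjunct in CHARACTER currency, on the class** (character `θ' = θ_Φ⁻¹ χ̄_p` of the quotient
line, LEAD g8 `HerbrandLineCharacters`). [cite: GreenbergLNM1716, §3 (PDF p. 86)] [cite: GreenbergVatsal2000, §2 pp. 16–17] -/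
theorem bottomResidualSelmer_quot_eq_bot_of_forall_hom_character (W : WeierstrassCurve ℚ) [W.IsElliptic]
    (hCM : W.HasCM) (hram : Rank1Residual.CMRamified W p) (h5 : 5 ≤ p) (K : Type) [Field K] [NumberField K]
    (hK2 : Module.finrank ℚ K = 2) (κ : ZpExtension K p) (𝔭 : HeightOneSpectrum (𝓞 K))
    (h𝔭 : ((p : ℕ) : 𝓞 K) ∈ 𝔭.asIdeal) (S₀ : Set (HeightOneSpectrum (𝓞 K)))
    (Φ : X2.ResidualDevissageModules.StableSubgroup (absoluteGaloisGroup K) ((W.baseChange K).geomTorsion (p : ℤ)))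
    (hcard : Nat.card Φ.Sub = p) (θ' : absoluteGaloisGroup K →* (ZMod p)ˣ)
    (hθ' : ∀ (g : absoluteGaloisGroup K) (y : Φ.Quot), g • y = (((θ' g : ZMod p).val : ℕ) : ℤ) • y)
    (hker' : ∀ g : absoluteGaloisGroup K, θ' g = 1 ↔ ∀ y : Φ.Quot, g • y = y)
    (hhom : ∀ f : absoluteGaloisGroup K → ZMod p, Continuous f →
      (∀ a b : absoluteGaloisGroup K, θ' a = 1 → θ' b = 1 → f (a * b) = f a + f b) →
      (∀ g n : absoluteGaloisGroup K, θ' n = 1 → f (g * n * g⁻¹) = (θ' g : ZMod p) * f n) →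
      (∀ v : HeightOneSpectrum (𝓞 K), v ∉ S₀ → ((p : ℕ) : 𝓞 K) ∉ v.asIdeal →
        ∀ σ n : absoluteGaloisGroup K, θ' n = 1 → σ * n * σ⁻¹ ∈ inertia v → f n = 0) →
      (∀ σ n : absoluteGaloisGroup K, θ' n = 1 → σ * n * σ⁻¹ ∈ decomp 𝔭 → f n = 0) →
      ∀ n : absoluteGaloisGroup K, θ' n = 1 → f n = 0) :
    datumStrictSelmer (κ.layerSubgroup 0) Φ.Quot p (AcSelmer.bdpData Φ.Quot p 𝔭) S₀ = ⊥ := by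
  haveI hE : (W.baseChange K).IsElliptic := by unfold WeierstrassCurve.baseChange; infer_instance
  exact datumStrictSelmer_bdpData_eq_bot_of_forall_hom_character (κ.layerSubgroup 0)
    (fun g ↦ by rw [ZpExtension.layerSubgroup_zero]; exact Subgroup.mem_top g)
    (HerbrandLineRestriction.natCard_quot_eq_of_card_sub (W.baseChange K) Φ hcard)
    (Φ.continuous_smul_quot (HerbrandLineRestriction.continuous_smul_geomTorsion (W.baseChange K) (p : ℤ)))
    (exists_smul_ne_sub_of_cmRamified W hCM hram h5 K hK2 Φ hcard).2 θ' hθ' hker' 𝔭 h𝔭 S₀ hhom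

end Class

end Summit.BirchSwinnertonDyer.BirchSwinnertonDyer.Theorems.PrintCFram.HerbrandSelmerToHom

end
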